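import Literature.MathematicalPhysics.QuantumFieldTheory.Balaban1983to89.Beta.RemainderDecay190

/-!
# [Balaban1987RG1] p. 282 ∕ [Balaban1985Variational] (190): the NUMERICS of the (190)-socket on the (4.4)-space model of
# row (D4) are JOINTLY SATISFIABLE against uniform piece constants — an explicit `Consts190` (`Beta.RemainderDecay190PiecesNumerics`)

statement-level skeleton of published theorems with citation tags; proofs where landed; nothing here is a claim
about the Yang–Mills mass gap.

HONEST FRAMING (cell rule).  Bookkeeping for the k-uniform remainder chain of row (D4) (`RemainderConst` ⇐ ONE
`ChainTFac190` instance, `Beta.RemainderDecay190`); discharges NOTHING of `BetaPertH`; NOT B12 Thm 2, NOT the continuum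
limit, NOT Clay.  Unit `b2b-balaban-beta-an4` gen 96 (BINDER row D4 OWNER; cell pub-balaban).  Imports
`Beta.RemainderDecay190` (the constants record `Consts190` and its printed sign ∕ rate budget `Valid`) ONLY; nothing edited.

WHAT.  The model-road END of this generation (`RemainderDecay190PeriodisedEnd` → `…ModelEnd` → `…ModelLocalEnd`,
staged) carries, besides the objects, a list of NUMERIC side conditions on the volume-, scale- and history-uniform
constants `q : Consts190`: the printed budget `q.Valid c.δ₀` ([15] (190) + [3] (2.61) ⟹ the p. 282 decay at rate `δ₀`:
`σ + τ ≤ ⅛δ15`, `δ₀ ≤ τθ`, signs) and the cube-torus socket's `0 < q.σ`, `c₀(q.σ∕δr)^d ≤ q.cR`, `1 ≤ q.κB`, `1 ≤ q.m`,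
`0 ≤ q.θ`, `q.θ·M ≤ 1`, and — against the four pieces' constants per (k, p) — `q.δ15 ≤ δ₀(k,p)∕2`, `C′(k,p)·K₁·K₁ ≤ q.Cst`.
**`exists_consts190_pieces`**: for every chain rate `δc > 0` (the `c.δ₀` of the B13 constants), cube side `M ≥ 1`,
row-sum reference rate `δr`, and UNIFORM piece data — a rate floor `δp` with `32·M·δc ≤ δp` and a constant ceiling `Cp ≥ 0`
— the record `q := (Cst := Cp, δ15 := 16Mδc, σ := Mδc, τ := Mδc, cR := max 0 (c₀(Mδc∕δr)^d), m := 1, θ := 1∕M, κB := 1)`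
satisfies ALL of them at once (`q.δ15 ≤ δp∕2`, `Cp ≤ q.Cst`; the user bounds his `δ₀(k,p) ≥ δp` and `C′(k,p)K₁K₁ ≤ Cp`).
So the numeric rows of the model road are not a hidden constraint beyond ONE located relation: the pieces must decay, per
fine-lattice site, at least `32·M` times the chain's cube-scale rate `δc` («k-uniform» = the floor `δp` and the ceiling
`Cp` do not depend on (k, p)).  WHAT IS *NOT* DONE: no value of Bałaban's constants is asserted; row D4 class UNCHANGED
(instance 0∕1; critical-path width 0 = NODE O; D4 DISCHARGE NO DATE).  No `def`, no named fact, no `sorry`, standard axioms.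
HONEST DEPENDENCY: continuum YM on T⁴ ⇐ BetaPertH ∧ nine spine estimates (0/9 proved); BetaPertH ⇐ (D1) ∧ (D4) ∧
CAP+tail; G-an2-4 gates asym, D1 and NE2/3/4.

Sources: [I] = T. Bałaban, Commun. Math. Phys. **109** (1987) 249–301 [Balaban1987RG1], p. 282, (5.10) p. 293; [15] = Commun.
Math. Phys. **102** (1985) 277–309 [Balaban1985Variational], (190) p. 308; [3] = Commun. Math. Phys. **96** (1984) 223–250
[Balaban1984PropagatorsII], (2.61) p. 234.
-/

namespace Literature.MathematicalPhysics.QuantumFieldTheory.Balaban1983to89.Beta.RemainderDecay190PiecesNumerics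

open Literature.MathematicalPhysics.QuantumFieldTheory.Balaban1983to89
open Literature.MathematicalPhysics.QuantumFieldTheory.Balaban1983to89.Beta.RemainderDecay190 (Consts190)

/-- **THE SOCKET NUMERICS OF THE MODEL ROAD ARE JOINTLY SATISFIABLE, EXPLICITLY.**  Given the chain rate `δc > 0`, the
cube side `M ≥ 1`, a row-sum reference rate `δr`, a uniform decay floor `δp` of the four pieces with `32·M·δc ≤ δp` and a
uniform constant ceiling `Cp ≥ 0`, there is `q : Consts190` with `q.Valid δc` and every side condition of the cube-torus
(190)-socket: `0 < q.σ`, `c₀(q.σ∕δr)^d ≤ q.cR`, `1 ≤ q.κB`, `q.δ15 ≤ δp∕2`, `Cp ≤ q.Cst`, `1 ≤ q.m`, `0 ≤ q.θ`, `q.θ·M ≤ 1`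
— namely `Cst := Cp`, `δ15 := 16Mδc`, `σ := τ := Mδc`, `cR := max 0 (c₀(Mδc∕δr)^d)`, `m := 1`, `θ := 1∕M`, `κB := 1`
(`σ + τ = 2Mδc = ⅛δ15`, `τθ = δc`). [cite: Balaban1985Variational, (190) p.308; Balaban1987RG1, p.282; Balaban1984PropagatorsII, (2.61) p.234] -/
theorem exists_consts190_pieces {d M : ℕ} [NeZero M] {δc : ℝ} (hδc : 0 < δc) (δr : ℝ) {δp Cp : ℝ}
    (hδp : 32 * (M : ℝ) * δc ≤ δp) (hCp : 0 ≤ Cp) :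
    ∃ q : Consts190, q.Valid δc ∧ 0 < q.σ ∧ B6.c0 δr (q.σ / δr) ^ d ≤ q.cR ∧ 1 ≤ q.κB ∧ q.δ15 ≤ δp / 2 ∧
      Cp ≤ q.Cst ∧ 1 ≤ q.m ∧ 0 ≤ q.θ ∧ q.θ * M ≤ 1 := by
  have hM : (0 : ℝ) < M := by exact_mod_cast Nat.pos_of_neZero M
  have hMδ : 0 < (M : ℝ) * δc := mul_pos hM hδc
  -- fields in order: Cst, δ15, σ, τ, cR, m, θ, κB
  refine ⟨⟨Cp, 16 * M * δc, M * δc, M * δc, max 0 (B6.c0 δr ((M : ℝ) * δc / δr) ^ d), 1, 1 / M, 1⟩, ?_, hMδ,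
    le_max_right _ _, le_rfl, ?_, le_rfl, le_rfl, ?_, ?_⟩
  · -- `Valid`: fields in order Cst, cR, m, κB, τ, στ, rate
    refine ⟨hCp, le_max_left _ _, zero_le_one, zero_le_one, hMδ.le, ?_, ?_⟩
    · show (M : ℝ) * δc + M * δc ≤ 16 * M * δc / 8
      linarith
    · show δc ≤ (M : ℝ) * δc * (1 / M)
      rw [mul_one_div, mul_comm, mul_div_assoc, div_self hM.ne', mul_one]
  · show 16 * (M : ℝ) * δc ≤ δp / 2
    linarith
  · show (0 : ℝ) ≤ 1 / M
    positivity
  · show 1 / (M : ℝ) * M ≤ 1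
    rw [one_div_mul_cancel hM.ne']

end Literature.MathematicalPhysics.QuantumFieldTheory.Balaban1983to89.Beta.RemainderDecay190PiecesNumerics
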